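import Literature.Probability.RandomPlanarGeometry.HexParafermionProofs
import Literature.Probability.LatticeModels.TriangularLatticeProofs

/-!
# The source law of the SAW parafermionic observable: port decomposition at the source vertex

Helper file for the item `SourceLoopBound` (stmt-CriticalPhenomena-8300) of the route
`SAWDevelopingMap` (sub-problem `SAWScalingLimit` of `CriticalPhenomena`), serving the crux
`NoFoldBound` (stmt-CriticalPhenomena-8296) at the SOURCE vertex.

Setting (Duminil-Copin–Smirnov 2012, §2): a finite vertex set `Λ` of the hexagonal lattice `ℍ`,
a boundary mid-edge `e = {u, v}` (`u ∉ Λ ∋ v`) and the two other neighbours `w₁, w₂` of `v`.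
Every self-avoiding walk from `e` enters the domain at `v`; a walk from `e` to the mid-edge
`a = {v, w₁}` is either the one-step walk `e → v → a`, or `e → v → w₂ → ⋯ → w₁ → a`, i.e. the
vertex `v` followed by a walk of `Λ ∖ {v}` from the mid-edge `b = {v, w₂}` to the mid-edge `a`
(a "returning loop" around `v`, the object of `SourceLoopBound`).  The winding is additive under
this decomposition, so for every fugacity `x` and spin `σ`

  `F_Λ(e; a) = x e^{-iσ W(e→v→a)} + x e^{-iσ W(e→v→b)} · F_{Λ∖v}(b; a)`      (`sourcePort`)

where `W(e→v→a)`, `W(e→v→b) = ±π/3` are the one-step windings (written below as the windings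
of the three-point polylines `mid(e), c(v), mid(a)` and `mid(e), c(v), mid(b)`).  This is the
exact "source law" quoted in the docstring of `SourceLoopBound`: at `x = x_c`, `σ = 5/8`, with the
deterministic winding `∓5π/3` of the returning loops in a simply connected domain, it reads
`F(a) = x_c e^{±5iπ/24} + x_c Z e^{±5iπ/6}` with `Z = Σ_loops x_c^ℓ` the sum bounded by the item,
and the no-fold inequality at `v` becomes `Z < sin(π/8)`.  No simple connectivity is needed here.

## Contents (namespace `Summit.CriticalPhenomena.SAWScalingLimit.Theorems.SourceLoopBound`)
* `eq_or_eq_or_eq_of_adj` — a vertex of `ℍ` has no fourth neighbour;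
* `head_eq`, `exists_loop_eq` — structure of the walks `e → a`: `verts = [v]`, or
  `verts = v :: δ.verts` for a walk `δ : b → a` of `Λ.erase v`; conversely `cons_*`;
* `weight_eq_of_verts_eq_cons` — additivity of length and winding, hence of the weight;
* **`sourcePort`** — the identity above.
-/

noncomputable section

open scoped BigOperators Classical
open Literature.Probability.LatticeModels Literature.Probability.RandomPlanarGeometry.SAW

namespace Summit.CriticalPhenomena.SAWScalingLimit.Theorems.SourceLoopBound

variable {Λ : Finset HexVertex} {u v w₁ w₂ : HexVertex}

/-- A vertex of the hexagonal lattice has exactly three neighbours: a neighbour of `v` is one of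
any three pairwise distinct neighbours `u, w₁, w₂` of `v`. -/
theorem eq_or_eq_or_eq_of_adj (huv : hexGraph.Adj v u) (h₁ : hexGraph.Adj v w₁)
    (h₂ : hexGraph.Adj v w₂) (hu₁ : u ≠ w₁) (hu₂ : u ≠ w₂) (h₁₂ : w₁ ≠ w₂) {y : HexVertex}
    (hy : hexGraph.Adj v y) : y = u ∨ y = w₁ ∨ y = w₂ := by
  by_cases hyu : y = u
  · exact Or.inl hyu
  by_cases hy₁ : y = w₁
  · exact Or.inr (Or.inl hy₁)
  by_cases hy₂ : y = w₂
  · exact Or.inr (Or.inr hy₂)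
  exfalso
  have h3 : (hexGraph.neighborSet v).ncard = 3 := card_neighborSet_hexGraph_holds v
  have hfin : (hexGraph.neighborSet v).Finite := Set.finite_of_ncard_ne_zero (by omega)
  have hsub : ({y, u, w₁, w₂} : Set HexVertex) ⊆ hexGraph.neighborSet v := by
    intro t ht
    simp only [Set.mem_insert_iff, Set.mem_singleton_iff] at ht
    rcases ht with rfl | rfl | rfl | rfl <;> simpa [SimpleGraph.mem_neighborSet]
  have h4 : ({y, u, w₁, w₂} : Set HexVertex).ncard = 4 := by
    rw [Set.ncard_insert_of_notMem (by simp [hyu, hy₁, hy₂]),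
      Set.ncard_insert_of_notMem (by simp [hu₁, hu₂]), Set.ncard_pair h₁₂]
  have := Set.ncard_le_ncard hsub hfin
  omega

section Walks

variable (hu : u ∉ Λ) (hv : v ∈ Λ) (huv : hexGraph.Adj v u) (h₁ : hexGraph.Adj v w₁)
  (h₂ : hexGraph.Adj v w₂) (hu₁ : u ≠ w₁) (hu₂ : u ≠ w₂) (h₁₂ : w₁ ≠ w₂)

/-! ### Walks from the boundary mid-edge `e = {u, v}` to `a = {v, w₁}` -/

include hu hv hu₁ in
/-- The mid-edges `e = {u,v}` and `a = {v,w₁}` are distinct. -/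
theorem mk_ne_mk : s(u, v) ≠ s(v, w₁) := by
  rw [Ne, Sym2.eq_iff]
  rintro (⟨h, -⟩ | ⟨h, -⟩)
  · exact hu (h ▸ hv)
  · exact hu₁ h

include hu hv hu₁ in
/-- A walk `e → a` is nontrivial. -/
theorem verts_ne_nil (γ : HexMidEdgeSAW Λ s(u, v) s(v, w₁)) : γ.verts ≠ [] :=
  fun h => mk_ne_mk hu hv hu₁ (γ.eq_of_nil h)

include hu hv hu₁ in
/-- A walk from the boundary mid-edge `e = {u, v}` starts at `v`. -/
theorem head_eq (γ : HexMidEdgeSAW Λ s(u, v) s(v, w₁)) : ∃ l, γ.verts = v :: l := by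
  obtain ⟨y, l, hyl⟩ := List.exists_cons_of_ne_nil (verts_ne_nil hu hv hu₁ γ)
  have hy : y ∈ s(u, v) := γ.head_mem y (by simp [hyl])
  rcases Sym2.mem_iff.1 hy with rfl | rfl
  · exact absurd (γ.subset y (by simp [hyl])) hu
  · exact ⟨l, hyl⟩

include hu hv huv h₁ h₂ hu₁ hu₂ h₁₂ in
/-- **Structure of the walks `e → a`.** Either the walk is the one-step walk `[v]`, or it
continues `v → w₂ → ⋯` and its tail is (the vertex list of) a walk of `Λ ∖ {v}` from
`b = {v, w₂}` to `a = {v, w₁}`. -/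
theorem exists_loop_eq (γ : HexMidEdgeSAW Λ s(u, v) s(v, w₁)) (hγ : γ.verts ≠ [v]) :
    ∃ δ : HexMidEdgeSAW (Λ.erase v) s(v, w₂) s(v, w₁), γ.verts = v :: δ.verts := by
  have hne := verts_ne_nil hu hv hu₁ γ
  obtain ⟨l, hl⟩ := head_eq hu hv hu₁ γ
  have hlne : l ≠ [] := by rintro rfl; exact hγ hl
  obtain ⟨y, l', rfl⟩ := List.exists_cons_of_ne_nil hlne
  have hnd := γ.nodup
  rw [hl] at hnd
  have hvl : v ∉ y :: l' := (List.nodup_cons.1 hnd).1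
  have hnd' : (y :: l').Nodup := (List.nodup_cons.1 hnd).2
  have hch := γ.isChain
  rw [hl] at hch
  have hvy : hexGraph.Adj v y := (List.isChain_cons_cons.1 hch).1
  have hch' : (y :: l').IsChain hexGraph.Adj := (List.isChain_cons_cons.1 hch).2
  have hyΛ : y ∈ Λ := γ.subset y (by simp [hl])
  -- the last vertex is `w₁`
  set z := (y :: l').getLast (List.cons_ne_nil y l') with hz
  have hlast : z ∈ s(v, w₁) := γ.getLast_mem z (by
    rw [hl, List.getLast?_cons_cons]; exact List.getLast?_eq_getLast_of_ne_nil _)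
  have hzmem : z ∈ y :: l' := List.getLast_mem _
  have hzw : z = w₁ := by
    rcases Sym2.mem_iff.1 hlast with h | h
    · exact absurd (h ▸ hzmem) hvl
    · exact h
  -- the second vertex is `w₂`
  have hy : y = w₂ := by
    rcases eq_or_eq_or_eq_of_adj huv h₁ h₂ hu₁ hu₂ h₁₂ hvy with h | h | h
    · exact absurd (h ▸ hyΛ) hu
    · -- `y = w₁` is the last vertex: `l' = []` by `Nodup`, and then the half-edge `a` is reused
      exfalso
      have hzy : z = y := hzw.trans h.symm
      have hl' : l' = [] := by
        by_contra hl'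
        have h3 : z = l'.getLast hl' := by rw [hz, List.getLast_cons hl']
        exact (List.nodup_cons.1 hnd').1 (hzy ▸ h3 ▸ List.getLast_mem hl')
      subst hl'
      have hed := γ.edges_nodup hne
      rw [hl, h] at hed
      simp at hed
    · exact h
  subst hy
  refine ⟨⟨_, ?_, hnd', hch', ?_, ?_, fun h => (List.cons_ne_nil _ _ h).elim, fun _ => ?_, ?_⟩,
    hl⟩
  · intro t ht
    exact Finset.mem_erase.2 ⟨fun htv => hvl (htv ▸ ht),
      γ.subset t (by rw [hl]; exact List.mem_cons_of_mem v ht)⟩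
  · intro t ht
    simp only [List.head?_cons, Option.some.injEq] at ht
    subst ht
    exact Sym2.mem_mk_right _ _
  · intro t ht
    exact γ.getLast_mem t (by rw [hl, List.getLast?_cons_cons]; exact ht)
  · -- the edge list of `δ` is the tail of the edge list of `γ`
    have hed := γ.edges_nodup hne
    rw [hl, edges_cons_cons] at hed
    exact (List.nodup_cons.1 hed).2
  · exact ⟨(SimpleGraph.mem_edgeSet hexGraph).2 h₂, _, Sym2.mem_mk_right _ _,
      Finset.mem_erase.2 ⟨h₂.ne.symm, hyΛ⟩⟩

/-! ### Returning loops `b = {v, w₂} → a` of `Λ ∖ {v}`, prefixed by `v` -/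

include h₁ h₁₂ in
/-- A returning loop `b → a` of `Λ ∖ {v}` is nontrivial (`b ≠ a`). -/
theorem loop_verts_ne_nil (δ : HexMidEdgeSAW (Λ.erase v) s(v, w₂) s(v, w₁)) : δ.verts ≠ [] := by
  intro h
  rcases Sym2.eq_iff.1 (δ.eq_of_nil h) with ⟨-, h'⟩ | ⟨h', -⟩
  · exact h₁₂ h'.symm
  · exact h₁.ne h'

include h₁ h₁₂ in
/-- A returning loop `b = {v, w₂} → a` of `Λ ∖ {v}` starts at `w₂`. -/
theorem loop_head_eq (δ : HexMidEdgeSAW (Λ.erase v) s(v, w₂) s(v, w₁)) :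
    ∃ rest, δ.verts = w₂ :: rest := by
  obtain ⟨y, rest, hy⟩ := List.exists_cons_of_ne_nil (loop_verts_ne_nil h₁ h₁₂ δ)
  have hmem : y ∈ s(v, w₂) := δ.head_mem y (by simp [hy])
  have hyv : y ≠ v := (Finset.mem_erase.1 (δ.subset y (by simp [hy]))).1
  rcases Sym2.mem_iff.1 hmem with h | h
  · exact absurd h hyv
  · exact ⟨rest, h ▸ hy⟩

include hv in
/-- Prefixing `v`: the vertices stay in `Λ`. -/
theorem cons_subset (δ : HexMidEdgeSAW (Λ.erase v) s(v, w₂) s(v, w₁)) :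
    ∀ t ∈ v :: δ.verts, t ∈ Λ := by
  intro t ht
  rcases List.mem_cons.1 ht with rfl | ht
  · exact hv
  · exact Finset.mem_of_mem_erase (δ.subset t ht)

/-- Prefixing `v` keeps the list duplicate-free (`v ∉ Λ ∖ {v}`). -/
theorem cons_nodup (δ : HexMidEdgeSAW (Λ.erase v) s(v, w₂) s(v, w₁)) : (v :: δ.verts).Nodup :=
  List.nodup_cons.2 ⟨fun h => (Finset.mem_erase.1 (δ.subset v h)).1 rfl, δ.nodup⟩

include h₁ h₂ h₁₂ in
/-- Prefixing `v` keeps consecutive vertices adjacent (`v ∼ w₂`). -/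
theorem cons_isChain (δ : HexMidEdgeSAW (Λ.erase v) s(v, w₂) s(v, w₁)) :
    (v :: δ.verts).IsChain hexGraph.Adj := by
  obtain ⟨rest, hr⟩ := loop_head_eq h₁ h₁₂ δ
  have hch := δ.isChain
  rw [hr] at hch ⊢
  exact List.IsChain.cons_cons h₂ hch

include h₁ h₁₂ in
/-- Prefixing `v` does not change the last vertex. -/
theorem cons_getLast_mem (δ : HexMidEdgeSAW (Λ.erase v) s(v, w₂) s(v, w₁)) :
    ∀ t, (v :: δ.verts).getLast? = some t → t ∈ s(v, w₁) := by
  intro t ht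
  obtain ⟨rest, hr⟩ := loop_head_eq h₁ h₁₂ δ
  refine δ.getLast_mem t ?_
  rw [hr] at ht ⊢
  rwa [List.getLast?_cons_cons] at ht

include hv huv in
/-- The boundary mid-edge `e = {u, v}` is a mid-edge of the domain. -/
theorem mk_mem_hexDomainMidEdges : s(u, v) ∈ hexDomainMidEdges Λ :=
  ⟨(SimpleGraph.mem_edgeSet hexGraph).2 huv.symm, v, Sym2.mem_mk_right u v, hv⟩

include hu hv h₁ hu₁ hu₂ h₁₂ in
/-- Prefixing `v`: the edge list `e, {v,w₂}, …, a` of the prolonged walk is duplicate-free. -/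
theorem cons_edges_nodup (δ : HexMidEdgeSAW (Λ.erase v) s(v, w₂) s(v, w₁)) :
    (s(u, v) :: List.zipWith (fun a b => s(a, b)) (v :: δ.verts) (v :: δ.verts).tail ++
      [s(v, w₁)]).Nodup := by
  obtain ⟨rest, hr⟩ := loop_head_eq h₁ h₁₂ δ
  have hed := δ.edges_nodup (loop_verts_ne_nil h₁ h₁₂ δ)
  rw [hr] at hed ⊢
  rw [edges_cons_cons]
  refine List.nodup_cons.2 ⟨fun hmem => ?_, hed⟩
  rcases List.mem_append.1 hmem with h | h
  · rcases List.mem_cons.1 h with h | h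
    · exact mk_ne_mk hu hv hu₂ h
    · have hu' : u ∈ w₂ :: rest := forall_mem_of_mem_edges _ _ h u (Sym2.mem_mk_left u v)
      rw [← hr] at hu'
      exact hu (Finset.mem_of_mem_erase (δ.subset u hu'))
  · exact mk_ne_mk hu hv hu₁ (List.mem_singleton.1 h)

include h₁ h₁₂ in
/-- **Additivity of the weight.** If the walk `γ : e → a` is `v` followed by the loop
`δ : b → a`, then `ℓ(γ) = ℓ(δ) + 1` and `W(γ) = W(e → v → b) + W(δ)` (the turn at `v`, then the
turns of `δ`; the half-edges at `b` are collinear with the edge `v w₂`), so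
`weight(γ) = x e^{-iσ W(e→v→b)} · weight(δ)`. -/
theorem weight_eq_of_verts_eq_cons (γ : HexMidEdgeSAW Λ s(u, v) s(v, w₁))
    (δ : HexMidEdgeSAW (Λ.erase v) s(v, w₂) s(v, w₁)) (hγδ : γ.verts = v :: δ.verts) (x σ : ℝ) :
    γ.weight x σ =
      (x : ℂ) * Complex.exp (-Complex.I * σ *
          (winding [hexMidpoint s(u, v), hexCenter v, hexMidpoint s(v, w₂)] : ℝ)) *
        δ.weight x σ := by
  obtain ⟨rest, hr⟩ := loop_head_eq h₁ h₁₂ δ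
  -- lengths
  have hlen : γ.length = δ.length + 1 := by
    rw [HexMidEdgeSAW.length, HexMidEdgeSAW.length, hγδ, List.length_cons]
  -- windings
  have hmid : hexMidpoint s(v, w₂) =
      hexCenter w₂ + (1 / 2 : ℝ) * (hexCenter v - hexCenter w₂) := by
    rw [hexMidpoint_mk]; push_cast; ring
  have hmid' : hexMidpoint s(v, w₂) =
      hexCenter v + (1 / 2 : ℝ) * (hexCenter w₂ - hexCenter v) := by
    rw [hexMidpoint_mk]; push_cast; ring
  have hW : γ.winding =
      winding [hexMidpoint s(u, v), hexCenter v, hexMidpoint s(v, w₂)] + δ.winding := by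
    simp only [HexMidEdgeSAW.winding, HexMidEdgeSAW.points, hγδ, hr, List.map_cons,
      List.cons_append, winding_cons_cons_cons, winding_pair, add_zero]
    congr 1
    · rw [hmid', HV.turning_right_ray (by norm_num)]
    · rw [hmid]
      exact (winding_cons_left_ray (t := 1 / 2) (by norm_num) _ _ _).symm
  rw [HexMidEdgeSAW.weight, HexMidEdgeSAW.weight, hW, hlen]
  push_cast
  rw [show -Complex.I * σ *
      ((winding [hexMidpoint s(u, v), hexCenter v, hexMidpoint s(v, w₂)] : ℂ) +
        (δ.winding : ℂ)) =
      -Complex.I * σ * (winding [hexMidpoint s(u, v), hexCenter v, hexMidpoint s(v, w₂)] : ℂ) +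
        -Complex.I * σ * (δ.winding : ℂ) by ring, Complex.exp_add, pow_succ]
  ring

/-! ### The source law -/

include hu hv huv h₁ h₂ hu₁ hu₂ h₁₂ in
/-- **The source law (port decomposition at the source vertex).** For a boundary mid-edge
`e = {u, v}` (`u ∉ Λ ∋ v`) and the two other neighbours `w₁, w₂` of `v`, at every fugacity `x`
and spin `σ`:
`F_Λ(e; {v,w₁}) = x e^{-iσ W(e→v→{v,w₁})} + x e^{-iσ W(e→v→{v,w₂})} · F_{Λ∖v}({v,w₂}; {v,w₁})`,
the one-step walk plus `v` followed by a returning loop of `Λ ∖ {v}` around `v`. -/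
theorem sourcePort (x σ : ℝ) :
    hexParafermionicObservable Λ s(u, v) x σ s(v, w₁) =
      (x : ℂ) * Complex.exp (-Complex.I * σ *
          (winding [hexMidpoint s(u, v), hexCenter v, hexMidpoint s(v, w₁)] : ℝ)) +
      (x : ℂ) * Complex.exp (-Complex.I * σ *
          (winding [hexMidpoint s(u, v), hexCenter v, hexMidpoint s(v, w₂)] : ℝ)) *
        hexParafermionicObservable (Λ.erase v) s(v, w₂) x σ s(v, w₁) := by
  classical
  -- the one-step walk `e → v → a`
  let γ₀ : HexMidEdgeSAW Λ s(u, v) s(v, w₁) :=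
    ⟨[v], fun t ht => by rw [List.mem_singleton.1 ht]; exact hv, List.nodup_singleton v,
      List.isChain_singleton v,
      fun t ht => by
        simp only [List.head?_cons, Option.some.injEq] at ht
        exact ht ▸ Sym2.mem_mk_right u v,
      fun t ht => by
        simp only [List.getLast?_singleton, Option.some.injEq] at ht
        exact ht ▸ Sym2.mem_mk_left v w₁,
      fun h => (List.cons_ne_nil _ _ h).elim,
      fun _ => List.nodup_cons.2
        ⟨List.mem_singleton.not.2 (mk_ne_mk hu hv hu₁), List.nodup_singleton _⟩,
      mk_mem_hexDomainMidEdges hv huv⟩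
  have hγ₀ : ∀ γ : HexMidEdgeSAW Λ s(u, v) s(v, w₁), γ = γ₀ ↔ γ.verts = [v] :=
    fun γ => ⟨fun h => h ▸ rfl, fun h => HexMidEdgeSAW.ext h⟩
  have h0 : γ₀.weight x σ = (x : ℂ) * Complex.exp (-Complex.I * σ *
      (winding [hexMidpoint s(u, v), hexCenter v, hexMidpoint s(v, w₁)] : ℝ)) := by
    rw [HexMidEdgeSAW.weight, mul_comm]
    simp only [HexMidEdgeSAW.winding, HexMidEdgeSAW.points, HexMidEdgeSAW.length, γ₀,
      List.map_cons, List.map_nil, List.cons_append, List.nil_append, List.length_singleton,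
      pow_one]
  rw [hexParafermionicObservable_def, hexParafermionicObservable_def,
    Fintype.sum_eq_add_sum_compl γ₀, h0, Finset.mul_sum]
  congr 1
  symm
  refine Finset.sum_bij (fun δ _ => ⟨v :: δ.verts, cons_subset hv δ, cons_nodup δ,
      cons_isChain h₁ h₂ h₁₂ δ,
      fun t ht => by
        simp only [List.head?_cons, Option.some.injEq] at ht
        exact ht ▸ Sym2.mem_mk_right u v,
      cons_getLast_mem h₁ h₁₂ δ, fun h => (List.cons_ne_nil _ _ h).elim,
      fun _ => cons_edges_nodup hu hv h₁ hu₁ hu₂ h₁₂ δ, mk_mem_hexDomainMidEdges hv huv⟩)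
    (fun δ _ => ?_) (fun δ₁ _ δ₂ _ h => ?_) (fun γ hγ => ?_) (fun δ _ => ?_)
  · -- lands outside `{γ₀}`
    rw [Finset.mem_compl, Finset.mem_singleton]
    intro h
    have h' := (hγ₀ _).1 h
    simp only [List.cons.injEq, true_and] at h'
    exact loop_verts_ne_nil h₁ h₁₂ δ h'
  · -- injective
    have h' := congrArg HexMidEdgeSAW.verts h
    simp only [List.cons.injEq, true_and] at h'
    exact HexMidEdgeSAW.ext h'
  · -- surjective
    rw [Finset.mem_compl, Finset.mem_singleton] at hγ
    have hne : γ.verts ≠ [v] := fun h => hγ ((hγ₀ γ).2 h)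
    obtain ⟨δ, hδ⟩ := exists_loop_eq hu hv huv h₁ h₂ hu₁ hu₂ h₁₂ γ hne
    exact ⟨δ, Finset.mem_univ _, HexMidEdgeSAW.ext hδ.symm⟩
  · -- weights
    exact (weight_eq_of_verts_eq_cons h₁ h₁₂ _ δ rfl x σ).symm

end Walks

end Summit.CriticalPhenomena.SAWScalingLimit.Theorems.SourceLoopBound
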